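import Summits.BirchSwinnertonDyer.BirchSwinnertonDyer.Theses.KatoDescentTamePotSupersingular
import Summits.BirchSwinnertonDyer.BirchSwinnertonDyer.Theorems.KatoDescentTamePotSupersingularTameUpperNonsurjTowerOfNamedFacts
import HarnessLib

/-!
# Route `KatoDescentTamePotSupersingular` (rung K8-t′, tame `p ≥ 5`, cell `bsd-potss`): glue item 23137
# `TameUpperNonsurjTowerOfFourNamedFacts` — the U₀-ns node `TameUpperNonsurjTower` (item 19202) from its split children
# (the four held named-fact aliases 23034–23037, shared with K9, and the road-inputs bundle 23136)

Cell `bsd-potss`, seat `bsd-potss-k9-c4` g13 (prover) landing the planner's staged closer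
(HOME/plan/rekey-g25/Closer_KT_TameUpperNonsurjTowerOfFourNamedFacts.lean, "ANY prover lands it";
`--workitem stmt-BirchSwinnertonDyer-23137`). Pure glue of plan g25's (36c) split of item 19202
(2026-08-27T22:4xZ, KT route rev 26/27): the four `Held…` aliases are by definition the four Literature
constants {Matar–Nekovář 2019 Thm 0.7, Gross 1991 Prop 3.7 (2), Poitou–Tate duality for Selmer
structures (∀ K), Gross–Zagier 1986 III (3.1) image-free}, the bundle `TameUpperNonsurjRoadInputs` is
the conjunction of the six route-side road inputs, and the kernel is seat k8t-c4 g13's landed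
`TameUpperNonsurjTowerOfNamedFacts.tameUpperNonsurjTower_of_structureIrred_of_namedFacts` (p572191).
HONEST FRAMING: this closes the GLUE item only; the node 19202 then rests BY NAME on four held published
facts and the bundle (whose conjuncts include the open residual `TameRankOne` and the Conj-A residue);
nothing is booked; BSD is not proved for any curve.
[cite: MatarNekovar2019, Thm. 0.7 (p. 456)] [cite: GrossLMS1991, Prop. 3.7 (2)] [cite: GrossZagier1986, III (3.1)]
[cite: MilneADT2006, Ch. I, Thm. 4.10] [cite: Jetchev2008, Cor. 1.5 (p. 812)]
-/

set_option autoImplicit false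
-- the Theorems directory repeats the summit name (sibling precedent `KatoDescentPotSupersingularAssembly.lean`)
set_option linter.dupNamespace false

namespace Summit.BirchSwinnertonDyer.BirchSwinnertonDyer.Theorems

open Summit.BirchSwinnertonDyer.BirchSwinnertonDyer.Theses.KatoDescentTamePotSupersingular

/-- **Glue 23137**: `HeldMatarNekovarThm07 → HeldGrossProp37Two → HeldPoitouTateSelmerDuality → HeldGrossZagierE0ImageFree →
TameUpperNonsurjRoadInputs → TameUpperNonsurjTower` — unfold the glue and the four held aliases, destructure the six-input
bundle, and apply k8t-c4 g13's landed kernel `TameUpperNonsurjTowerOfNamedFacts.tameUpperNonsurjTower_of_structureIrred_of_namedFacts`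
(p572191). [cite: MatarNekovar2019, Thm. 0.7 (p. 456)] [cite: GrossLMS1991, Prop. 3.7 (2)] [cite: Jetchev2008, Cor. 1.5 (p. 812)] -/
theorem tameUpperNonsurjTowerOfFourNamedFacts_proof : TameUpperNonsurjTowerOfFourNamedFacts := by
  unfold TameUpperNonsurjTowerOfFourNamedFacts HeldMatarNekovarThm07 HeldGrossProp37Two HeldPoitouTateSelmerDuality
    HeldGrossZagierE0ImageFree TameUpperNonsurjRoadInputs
  intro h1 h2 h3 h4 hI
  exact TameUpperNonsurjTowerOfNamedFacts.tameUpperNonsurjTower_of_structureIrred_of_namedFacts h1 h2 h3 h4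
    hI.1 hI.2.1 hI.2.2.1 hI.2.2.2.1 hI.2.2.2.2.1 hI.2.2.2.2.2

end Summit.BirchSwinnertonDyer.BirchSwinnertonDyer.Theorems
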